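import Literature.MathematicalPhysics.QuantumFieldTheory.Balaban1983to89.B8Prop6CubeMemberOfThm33Gamma
import Literature.MathematicalPhysics.QuantumFieldTheory.Balaban1983to89.B8CubeMemberLevelSep

/-!
# `Balaban1983to89.B8Prop6CubeMemberOfThm33GammaAvg` — [Balaban1985RegularSpaces] PROPOSITION 6 (p. 99) ON NODE 00's CUBE MEMBER `Node00.zdCub` FROM
# [Balaban1985BackgroundPropagators] THEOREM 3.3 BY NAME, EDITION γ, WITH THE GENUINE AVERAGING LETTER («D3γ′»): the junction knit of
# `B8Prop6CubeMemberOfThm33Gamma` with its `havg` binder DISCHARGED — the averaging term of (3.26) is print's `Q*aQ` (3.16) read over print's split class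

statement-level skeleton of published theorems with citation tags; proofs where landed; nothing here is a claim about the
Yang–Mills mass gap

PDF held: `paper:balaban1985-cmp99-regular-spaces-gauge-fixing`; p. 99 (Proposition 6), Theorem 4 p. 88, Proposition 3 p. 87, Proposition 5 (1.107)–(1.108) p. 94,
(1.31) p. 82, (1.56)–(1.59) p. 86, p. 77; [4] `[Balaban1985BackgroundPropagators]` Thm 3.3 p. 399, (3.16) p. 393, (3.26)–(3.27) p. 395; [B6] `[Balaban1984PropagatorsII]` (2.3) p. 224.

CITATION HEADER (lean-in-tree rule).  Cell `pub-ymgap` (HUMAN RULING D-0062, Track A), DAG node N05 = [B8]; width seat `pub-ymgap-k0-s2-w1` (g3), the author of «D3γ»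
`B8Prop6CubeMemberOfThm33Gamma` (p588186).  WHY THIS FILE.  In D3γ's junction knit `prop6Printed_zdCub_of_thm33γ₃` the averaging binder
`havg : ∀ M j m, AvgAtγ L ops q (cubeLamBP' …) M j.1.1 m` — «(Lʲη)³‖(Q*aQ A)(b)‖ ≤ q·|B₁|(A)», [4] (3.16) with (1.56)∕(1.58) — is a free HYPOTHESIS about an
abstract operator letter `(ops M i m).QQ` (referee READ-55 NIT (2): unguarded in `m`).  dag-n06-b's edition P `B9Eq316AveragingTransposeZdPrinted` (p596576) now DEFINES
print's genuine letter `QQZdP τ L ΛbP` = `Σ_{j ≤ m} w_j·Q_jᵀ(𝟙_{Λ_j}LʲηQ_jA)` and the letter family `withQQP τ L ΛbP ops₀` (`ops₀` with `QQ := QQZdP …`), and PROVES the binder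
for it (`avgAtγ_withQQP`) under the class law `LevelSepPP L m Ω ΛbP 1`; dag-n05-c's `B8CubeMemberLevelSep` (p597648) PROVES that law at the cube tower for the TRUNCATED split
class `ΛbT = fun m' => if m' ≤ k then cubeLamBP' L a M ρ k m' else fun _ => ∅` at EVERY `m` (`levelSepPP_cubeLamBP'_trunc'_of_eq`; the untruncated law is false
above the tower, `not_levelSepPP_cubeLamBP'_of_ge`).  THIS FILE is the first consumer of both at the cube road (dag-n06-b WORD 2026-08-28 02:21Z «the truncated-class
recipe is how `havg` at `cubeLamBP'` gets the GENUINE averaging letter»; plug certified 02:28Z): D3γ re-run with `ops := withQQP τ L ΛbT ops₀` PER CUBE DATUM through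
dag-n06-b's explicit-constant supplier `sockB9P3D4γ_allLevels_explicit_on` (constants datum-free because explicit), the `havg` binder supplied by
`avgAtγ_withQQP ∘ levelSepPP_cubeLamBP'_trunc'_of_eq`, the sockets transported from `ΛbT m` to `cubeLamBP' … m` (`if_pos`, `m ≤ k`).  Kind «kernel-checked proof»,
theorems only, no `def`.

WHAT IS PROVED (kernel, 0 sorry).
§0 bookkeeping: `dictAt_withQQP_iff`, `curvAt_withQQP_iff`, `landauAt_withQQP_iff` — the binders reading only `Gop` ∕ `Dp` ∕ `DRDs` do not see the `QQ` replacement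
   (`Iff` by unfolding; `InvAt` DOES see it: it reads `deltaAOf η (ops M i m) = J + Dp + DRDs + QQ`, [4] (3.26)); `sockB9P3D4β_of_level_eq` (the four-line socket at
   truncation `m` reads the class map only at level `m`); `qQ_one_nonneg`.
§1 ★★ `sockD4γ_cubeMember_of_thm33_genuineAvg` — at every member of D3γ's datum-carrying cube sub-family `J′` and every `m ≤ k`: the all-levels γ four-line socket
   `SockB9P3D4β L B₀ᴰ B_∂ c_{P9} η m {□_j} Λ′ (cubeLamBP' …)` with dag-n06-b's EXPLICIT constants, from `B9.Thm33Printed` BY NAME + `DictAt`∕`CurvAt`∕`LandauAt` at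
   ANY letter family `ops₀` + `Prop6At` + `InvAt` AT THE GENUINE LETTER `withQQP τ L ΛbT ops₀` — and NO averaging binder.
§2 ★★★ `prop6Printed_zdCub_of_thm33γ₄` — D3γ's `prop6Printed_zdCub_of_thm33γ₃` with the `havg` BINDER GONE (and `InvAt` at the genuine letter): `∃ B₀ˢ ≥ 1,
   ∀ {B₀′ c_P} > 0, SockP5base@(B₀ˢ) → SockP5@(B₀ˢ) → ∃ c₁ > 0, ∀ f, B8.Prop6Printed d L (5dL·B₀ˢ) c₁ (zdCub ∘ f)` — the plug shape of this seat's K0 door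
   `K0Stub2OfPrintedZdCub.prop6MemberB8At_of_prop6PrintedFamily` (p584116) ∕ D2γ `K0Stub2OfSockGamma` (p588442), verbatim.

HONEST SCOPE ∕ A6 (director-ym №189 (3)).  Compositions by name; nothing of [4] or of Propositions 3∕5∕6 is proved.  Every remaining socket∕binder is a HYPOTHESIS:
`B9.Thm33Printed` (N06's node), the member-local dictionary `DictAt` and letters `Prop6At`, `CurvAt`, `LandauAt` (at any `ops₀`), `InvAt` at the genuine letter
(= [4] (3.27): `G(U₀)` inverts (3.26) WITH the averaging term `Q*aQ` on `E(Ω₀)` — the print-faithful reading; N06's Thm 3.1∕3.3 object layer), Proposition 5's two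
existence sockets at cube members (N05's Prop.-5 lane; no cube-member provider in tree).  NOT witnessed here: dag-n06-b's `m = 0` witness
(`B9SupplySockB9P3ZdGamma.…nonvacuous_cubeLamBP'_zero`) inhabits the binder list for a FREE letter family; with `QQ` pinned to `QQZdP` the `InvAt` row is no longer
free, and no joint-satisfiability claim is made.  Extra standing hypotheses vs D3γ: `[FiniteDimensional ℝ 𝔸]`, a functional `τ : 𝔸 →ₗ[ℂ] ℂ` with
`|Re τ(x*y)| ≤ C_τ‖x‖‖y‖` (print: `τ = tr`, [4] p. 391), and `q := qQ d L C_τ β_τ 1` is now a NAMED constant, not a parameter.  LOCATED-CARRIER unchanged (dag-n05-e;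
k0-s2-w2 p584299): binders∕sockets are asked at EVERY `CubeB8` cube datum (collars `ρ = L` included) — beyond print's p. 98 cubes.  The Thm-3.3 road is an ALTERNATIVE
supplier of the K0⁷ V19 stub-2′ ∕ V18 stub-2 sentence (closed by the flat line, p593845 ∕ p595104): nothing here moves K0⁷ stmt-QuantumFields-20541 (OPEN: stubs 1 ∧ 3ᴬ′);
count-neutral; N05∕N06 NOT discharged; one finite `𝕋⁴` programme at fixed `ε`, Bałaban AS PRINTED; nothing continuum ∕ ℝ⁴ ∕ OS ∕ mass-gap ∕ Clay (the Yang–Mills mass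
gap is NOT proved by any of this; route R4 closes the conditional finite-𝕋⁴ rung `BalabanLadder.UV` only).  No `sorry`, no `def`, no `instance`, no `notation`.
Unit `pub-ymgap-k0-s2-w1` (g3), 2026-08-28.

RELATED IN THE TREE, NOT DUPLICATED (USED by name): `B8Prop6CubeMemberOfThm33Gamma.prop6Printed_zdCub_of_sockD4γFamily₃` (D3γ §1, binder-agnostic consumer),
`B9SupplySockB9P3ZdGamma.{cubeLamBP', seesDom_cubeLamBP', sockB9P3D4γ_allLevels_explicit_on, AvgAtγ, SeesDom}` (dag-n06-b),
`B9Eq316AveragingTransposeZdPrinted.{withQQP, QQZdP, avgAtγ_withQQP, LevelSepPP}` (dag-n06-b, p596576), `B9Eq316AveragingTransposeZd.{qQ, betaTau}`,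
`B8CubeMemberLevelSep.levelSepPP_cubeLamBP'_trunc'_of_eq` (dag-n05-c, p597648), `B9SupplySockB9P3ZdLettersOmega.margin2_cubeFam`, `Node00.zdCub`.
-/

noncomputable section

open NormedSpace

namespace Literature.MathematicalPhysics.QuantumFieldTheory.Balaban1983to89.B8Prop6CubeMemberOfThm33GammaAvg

open B7Prop2Explicit (unitaryUnits)
open B7Prop5GeneralLevels (thetaGen)
open B8LeafModelZd (ZdIdx SockP5base SockP5)
open B8Eq131CubesAdmissible (cubeFam)
open B8CubeMemberZd (cubeLamS cubeLamB hΩ_cubeFam hbox_cubeLamB hclass_cubeLamB htower_cubeLam hpart_cubeLam)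
open B9SupplySockB9P3ZdLetters (OpsZd)
open B9SupplySockB9P3ZdLettersOmega (Margin2 margin2_cubeFam)
open B9SupplySockB9P3ZdAt (DictAt Prop6At InvAt CurvAt LandauAt)
open B9SupplySockB9P3ZdBeta (SockB9P3D4β)
open B9SupplySockB9P3ZdGamma (cubeLamBP' seesDom_cubeLamBP' SeesDom AvgAtγ sockB9P3D4γ_allLevels_explicit_on)
open B9Eq316AveragingTransposeZd (qQ betaTau alphaQ alphaQ_pos)
open B9Eq316AveragingTransposeZdPrinted (withQQP avgAtγ_withQQP LevelSepPP)
open B8CubeMemberLevelSep (levelSepPP_cubeLamBP'_trunc'_of_eq)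
open B8Prop6CubeMemberOfThm33Gamma (prop6Printed_zdCub_of_sockD4γFamily₃)
open Node00 (zdCub)

-- `Site` alone could resolve to the torus sites of `Setup.lean`; re-export the `ℤ^d` sites of `B7Prop1Explicit`.
export B7Prop1Explicit (Site)

variable {d : ℕ}

variable {𝔸 : Type} [CStarAlgebra 𝔸] [Nontrivial 𝔸] [FiniteDimensional ℝ 𝔸]

/-! ## §0 Bookkeeping: which member-local binders see the `QQ` replacement; the socket reads the class at its own level; `q ≥ 0` -/

section Bookkeeping

variable {I : Type} (geo : I → B9.Geometry) (bg : I → B9.Backgrounds) (GA : ∀ i, B9.KernelFamily (geo i) (bg i))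
variable (L : ℕ) (mem : ℝ → ZdIdx d L → ℕ → I)
variable (ιCfg : ∀ (M : ℝ) (i : ZdIdx d L) (m : ℕ) (U₀ : Site d → Fin d → 𝔸ˣ), (∀ x κ, U₀ x κ ∈ unitaryUnits 𝔸) → (bg (mem M i m)).Cfg)
variable (ιLoc : ∀ (M : ℝ) (i : ZdIdx d L) (m : ℕ), (Site d → Fin d → 𝔸) → (geo (mem M i m)).Loc)
variable (τ : 𝔸 →ₗ[ℂ] ℂ)

omit [Nontrivial 𝔸] in
/-- `DictAt` reads only the `Gop` field of the letter family, so it does not see dag-n06-b's `QQ` replacement `withQQP`. [cite: Balaban1985BackgroundPropagators, (3.26) p.395 (bookkeeping)] -/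
theorem dictAt_withQQP_iff (ΛbP : ℕ → ℕ → Set (Site d × Fin d)) (ops₀ : ℝ → ZdIdx d L → ℕ → OpsZd d 𝔸) (M : ℝ) (i : ZdIdx d L) (m : ℕ) :
    DictAt geo bg GA L mem ιCfg ιLoc (withQQP τ L ΛbP ops₀) M i m ↔ DictAt geo bg GA L mem ιCfg ιLoc ops₀ M i m :=
  Iff.rfl

omit [Nontrivial 𝔸] in
/-- `CurvAt` ((3.69)) reads only the `Dp` field, so it does not see the `QQ` replacement. [cite: Balaban1985BackgroundPropagators, (3.69) p.404 (bookkeeping)] -/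
theorem curvAt_withQQP_iff (ΛbP : ℕ → ℕ → Set (Site d × Fin d)) (ops₀ : ℝ → ZdIdx d L → ℕ → OpsZd d 𝔸) (c35 a₃ c69 M : ℝ) (i : ZdIdx d L) (m : ℕ) :
    CurvAt bg L mem ιCfg (withQQP τ L ΛbP ops₀) c35 a₃ c69 M i m ↔ CurvAt bg L mem ιCfg ops₀ c35 a₃ c69 M i m :=
  Iff.rfl

omit [Nontrivial 𝔸] in
/-- `LandauAt` ((3.20)–(3.21)) reads only the `DRDs` field, so it does not see the `QQ` replacement. [cite: Balaban1985BackgroundPropagators, (3.20)–(3.21) p.394 (bookkeeping)] -/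
theorem landauAt_withQQP_iff (ΛbP : ℕ → ℕ → Set (Site d × Fin d)) (ops₀ : ℝ → ZdIdx d L → ℕ → OpsZd d 𝔸) (c35 a₃ M : ℝ) (i : ZdIdx d L) (m : ℕ) :
    LandauAt bg L mem ιCfg (withQQP τ L ΛbP ops₀) c35 a₃ M i m ↔ LandauAt bg L mem ιCfg ops₀ c35 a₃ M i m :=
  Iff.rfl

omit [Nontrivial 𝔸] [FiniteDimensional ℝ 𝔸] in
/-- The four-line socket at truncation `m` reads the datum class map only at level `m` (its `|B₁|` runs over `Λb m ·`), so two class maps agreeing at `m` give the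
same socket. [cite: Balaban1985RegularSpaces, (1.56)–(1.59) p.86 (bookkeeping)] -/
theorem sockB9P3D4β_of_level_eq {B₀ Bbd cP η : ℝ} {m : ℕ} {Ω : ℕ → Set (Site d)} {Λs : ℕ → ℕ → Set (Site d)}
    {Λb Λb' : ℕ → ℕ → Set (Site d × Fin d)} (h : Λb m = Λb' m) (hS : SockB9P3D4β (𝔸 := 𝔸) L B₀ Bbd cP η m Ω Λs Λb) :
    SockB9P3D4β (𝔸 := 𝔸) L B₀ Bbd cP η m Ω Λs Λb' := by
  unfold SockB9P3D4β at hS ⊢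
  rw [← h]
  exact hS

/-- `q = qQ d L C_τ β_τ 1 ≥ 0` when `C_τ` bounds `|Re τ(x*y)|` (so `C_τ ≥ 0`). [cite: Balaban1985BackgroundPropagators, (3.16) p.393 (bookkeeping)] -/
theorem qQ_one_nonneg (hL : 1 ≤ L) {Cτ : ℝ} (hCτ : ∀ x y : 𝔸, |(τ (star x * y)).re| ≤ Cτ * ‖x‖ * ‖y‖) : 0 ≤ qQ d L Cτ (betaTau τ) 1 := by
  have hCτ0 : 0 ≤ Cτ := by
    have h := hCτ 1 1
    simp only [norm_one, mul_one] at h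
    exact (abs_nonneg _).trans h
  have hβ : 0 ≤ betaTau τ := by
    unfold betaTau
    split_ifs
    · exact Finset.sum_nonneg fun i _ => mul_nonneg (norm_nonneg _) (norm_nonneg _)
    · exact le_rfl
  have hθ : 0 ≤ 1 + thetaGen d L (alphaQ d L) := by
    have := alphaQ_pos d hL
    unfold thetaGen
    positivity
  unfold qQ
  positivity

end Bookkeeping

/-! ## §1 The explicit γ socket family at the cube members from Theorem 3.3 by name, WITH THE GENUINE AVERAGING LETTER (no `havg`) -/

section Supply

variable {I : Type} (geo : I → B9.Geometry) (bg : I → B9.Backgrounds) (GA : ∀ i, B9.KernelFamily (geo i) (bg i))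
variable (L : ℕ) (mem : ℝ → ZdIdx d L → ℕ → I)
variable (ιCfg : ∀ (M : ℝ) (i : ZdIdx d L) (m : ℕ) (U₀ : Site d → Fin d → 𝔸ˣ), (∀ x κ, U₀ x κ ∈ unitaryUnits 𝔸) → (bg (mem M i m)).Cfg)
variable (ιLoc : ∀ (M : ℝ) (i : ZdIdx d L) (m : ℕ), (Site d → Fin d → 𝔸) → (geo (mem M i m)).Loc)
variable (τ : 𝔸 →ₗ[ℂ] ℂ) (ops₀ : ℝ → ZdIdx d L → ℕ → OpsZd d 𝔸)

set_option maxHeartbeats 400000 in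
/-- ★★ **THE EXPLICIT γ FOUR-LINE SOCKET FAMILY OVER PRINT'S SPLIT CLASS AT THE CUBE MEMBERS, FROM [4] THEOREM 3.3 BY NAME, WITH THE GENUINE AVERAGING LETTER.**
On D3γ's datum-carrying cube sub-family `J′` (a member `i` with `(a, M, ρ)` presenting its domains): `B9.Thm33Printed` + the member-local dictionary `DictAt` and the
letters `CurvAt`, `LandauAt` at ANY letter family `ops₀` + `Prop6At` + `InvAt` AT THE GENUINE LETTER `withQQP τ L ΛbT ops₀` (`ΛbT` = the truncated split class of
the member's cube datum) give, for SOME `B₀ > 0`, `c_{P9} > 0` depending on Theorem 3.3's block and `(c₆, K₆, a₃, c₆₉, q)` only, the socket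
`SockB9P3D4β L (max 1 (2B₀·max 1 q)) ((20d+2)·max 1 (2B₀·max 1 q)) c_{P9} η m {□_j} Λ′ (cubeLamBP' …)` at every member and every `m ≤ k` — dag-n06-b's
`sockB9P3D4γ_allLevels_explicit_on` called PER MEMBER with `ops := withQQP τ L ΛbT ops₀`, its `havg` binder supplied by `avgAtγ_withQQP` ∘ dag-n05-c's
`levelSepPP_cubeLamBP'_trunc'_of_eq` (`q = qQ d L C_τ β_τ 1`), `SeesDom` by `seesDom_cubeLamBP'`, `Margin2` by `margin2_cubeFam`, and the socket read back at
`cubeLamBP' … m = ΛbT m` (`if_pos`).  A6 line in the module docstring.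
[cite: Balaban1985RegularSpaces, (1.56)–(1.59) p.86, (1.31) p.82, Thm 4 p.88, p.77; Balaban1985BackgroundPropagators, Thm 3.3 p.399, (3.16) p.393, (3.26)–(3.27) p.395; Balaban1984PropagatorsII, (2.3) p.224] -/
theorem sockD4γ_cubeMember_of_thm33_genuineAvg (hd2 : 2 ≤ d) (hL : 2 ≤ L)
    {Cτ : ℝ} (hCτ : ∀ x y : 𝔸, |(τ (star x * y)).re| ≤ Cτ * ‖x‖ * ‖y‖)
    {c35 c₆ K₆ M₃ a₃ c69 : ℝ} {Gp : ∀ i, B9.KernelFamily (geo i) (bg i)} (h33 : B9.Thm33Printed c35 geo bg Gp GA)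
    (hdict : ∀ (M : ℝ) (j : {q : ZdIdx d L × (Site d × ℕ × ℕ) // L ≤ q.2.2.2 ∧ q.2.2.2 ≤ q.2.2.1 ∧ 11 * d < q.2.2.1 ∧ L ≤ d * q.2.2.1 ∧
          q.1.Ω = cubeFam false L q.2.1 q.2.2.1 q.2.2.2 q.1.k ∧ q.1.Λs = cubeLamS L q.2.1 q.2.2.1 q.2.2.2 q.1.k ∧ q.1.Λb = cubeLamB L q.2.1 q.2.2.1 q.2.2.2 q.1.k}) (m : ℕ),
      DictAt geo bg GA L mem ιCfg ιLoc ops₀ M j.1.1 m)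
    (hP6 : ∀ (M : ℝ) (j : {q : ZdIdx d L × (Site d × ℕ × ℕ) // L ≤ q.2.2.2 ∧ q.2.2.2 ≤ q.2.2.1 ∧ 11 * d < q.2.2.1 ∧ L ≤ d * q.2.2.1 ∧
          q.1.Ω = cubeFam false L q.2.1 q.2.2.1 q.2.2.2 q.1.k ∧ q.1.Λs = cubeLamS L q.2.1 q.2.2.1 q.2.2.2 q.1.k ∧ q.1.Λb = cubeLamB L q.2.1 q.2.2.1 q.2.2.2 q.1.k}) (m : ℕ),
      M₃ ≤ M → Prop6At bg L mem ιCfg c35 c₆ K₆ M j.1.1 m)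
    (hinv : ∀ (M : ℝ) (j : {q : ZdIdx d L × (Site d × ℕ × ℕ) // L ≤ q.2.2.2 ∧ q.2.2.2 ≤ q.2.2.1 ∧ 11 * d < q.2.2.1 ∧ L ≤ d * q.2.2.1 ∧
          q.1.Ω = cubeFam false L q.2.1 q.2.2.1 q.2.2.2 q.1.k ∧ q.1.Λs = cubeLamS L q.2.1 q.2.2.1 q.2.2.2 q.1.k ∧ q.1.Λb = cubeLamB L q.2.1 q.2.2.1 q.2.2.2 q.1.k}) (m : ℕ),
      M₃ ≤ M → InvAt bg L mem ιCfg
        (withQQP τ L (fun m' => if m' ≤ j.1.1.k then cubeLamBP' L j.1.2.1 j.1.2.2.1 j.1.2.2.2 j.1.1.k m' else fun _ => ∅) ops₀) c35 a₃ M j.1.1 m)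
    (hcurv : ∀ (M : ℝ) (j : {q : ZdIdx d L × (Site d × ℕ × ℕ) // L ≤ q.2.2.2 ∧ q.2.2.2 ≤ q.2.2.1 ∧ 11 * d < q.2.2.1 ∧ L ≤ d * q.2.2.1 ∧
          q.1.Ω = cubeFam false L q.2.1 q.2.2.1 q.2.2.2 q.1.k ∧ q.1.Λs = cubeLamS L q.2.1 q.2.2.1 q.2.2.2 q.1.k ∧ q.1.Λb = cubeLamB L q.2.1 q.2.2.1 q.2.2.2 q.1.k}) (m : ℕ),
      M₃ ≤ M → CurvAt bg L mem ιCfg ops₀ c35 a₃ c69 M j.1.1 m)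
    (hlan : ∀ (M : ℝ) (j : {q : ZdIdx d L × (Site d × ℕ × ℕ) // L ≤ q.2.2.2 ∧ q.2.2.2 ≤ q.2.2.1 ∧ 11 * d < q.2.2.1 ∧ L ≤ d * q.2.2.1 ∧
          q.1.Ω = cubeFam false L q.2.1 q.2.2.1 q.2.2.2 q.1.k ∧ q.1.Λs = cubeLamS L q.2.1 q.2.2.1 q.2.2.2 q.1.k ∧ q.1.Λb = cubeLamB L q.2.1 q.2.2.1 q.2.2.2 q.1.k}) (m : ℕ),
      M₃ ≤ M → LandauAt bg L mem ιCfg ops₀ c35 a₃ M j.1.1 m)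
    (hc₆ : 0 < c₆) (hK₆ : 0 < K₆) (ha₃ : 0 < a₃) (hc69 : 0 ≤ c69) :
    ∃ B₀ cP9 : ℝ, 0 < B₀ ∧ 0 < cP9 ∧
      ∀ (j : {q : ZdIdx d L × (Site d × ℕ × ℕ) // L ≤ q.2.2.2 ∧ q.2.2.2 ≤ q.2.2.1 ∧ 11 * d < q.2.2.1 ∧ L ≤ d * q.2.2.1 ∧
          q.1.Ω = cubeFam false L q.2.1 q.2.2.1 q.2.2.2 q.1.k ∧ q.1.Λs = cubeLamS L q.2.1 q.2.2.1 q.2.2.2 q.1.k ∧ q.1.Λb = cubeLamB L q.2.1 q.2.2.1 q.2.2.2 q.1.k}) (m : ℕ),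
        m ≤ j.1.1.k →
        SockB9P3D4β (𝔸 := 𝔸) L (max 1 (2 * B₀ * max 1 (qQ d L Cτ (betaTau τ) 1))) ((20 * d + 2) * max 1 (2 * B₀ * max 1 (qQ d L Cτ (betaTau τ) 1))) cP9
          j.1.1.η m j.1.1.Ω j.1.1.Λs (cubeLamBP' L j.1.2.1 j.1.2.2.1 j.1.2.2.2 j.1.1.k) := by
  have hL1 : 1 ≤ L := le_trans (by norm_num) hL
  have hq : 0 ≤ qQ d L Cτ (betaTau τ) 1 := qQ_one_nonneg L τ hL1 hCτ
  -- Theorem 3.3's block for `G(U)` (the `GA` half), at its printed constants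
  obtain ⟨M₁, δ₀, a₀, B₀, Bβ, Bε, Bεβ, -, -, ha₀, hB₀, H⟩ := h33
  have HA : ∀ i : I, M₁ ≤ (geo i).M → ∀ α₀ : ℝ, 0 < α₀ → (geo i).M * α₀ ≤ a₀ →
      ∀ U : (bg i).Cfg, (bg i).Reg335 c35 α₀ U → B9.Ineq342_346_347 (GA i) B₀ δ₀ U ∧ B9.Ineq343_345 (GA i) Bβ Bε Bεβ δ₀ U :=
    fun i hMi α₀ hα₀ hMa U hreg => (H i hMi α₀ hα₀ hMa U hreg).2
  -- the common block-size threshold `M⋆ = max {1, M₁, M₃}`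
  obtain ⟨Ms, hMs_def⟩ : ∃ Ms : ℝ, Ms = max 1 (max M₁ M₃) := ⟨_, rfl⟩
  have hM1 : 1 ≤ Ms := by rw [hMs_def]; exact le_max_left _ _
  have hMM₁ : M₁ ≤ Ms := by rw [hMs_def]; exact (le_max_left _ _).trans (le_max_right _ _)
  have hMM₃ : M₃ ≤ Ms := by rw [hMs_def]; exact (le_max_right _ _).trans (le_max_right _ _)
  have hM0 : 0 < Ms := lt_of_lt_of_le one_pos hM1
  have hKM : 0 < K₆ * Ms := mul_pos hK₆ hM0
  refine ⟨B₀, min (1 / 16) (min (c₆ / Ms) (min (a₀ / (K₆ * Ms)) (min (a₃ / (K₆ * Ms)) (1 / (2 * B₀ * c69 * K₆ * Ms + 1))))), hB₀, ?_,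
    fun j m hm => ?_⟩
  · refine lt_min (by norm_num) (lt_min (div_pos hc₆ hM0) (lt_min (div_pos ha₀ hKM) (lt_min (div_pos ha₃ hKM) ?_)))
    have : 0 < 2 * B₀ * c69 * K₆ * Ms + 1 := by positivity
    positivity
  -- the member `j` and its cube datum
  obtain ⟨⟨i, a, M, ρ⟩, hρL, hρM, hMbig, hLdM, hΩ, hΛs, hΛb⟩ := j
  dsimp only at hρL hρM hMbig hLdM hΩ hΛs hΛb hm ⊢
  -- ONE call of dag-n06-b's explicit supplier AT THIS MEMBER, letter family `withQQP τ L ΛbT ops₀`, class map `ΛbT` (truncated split class)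
  have h := sockB9P3D4γ_allLevels_explicit_on geo bg GA L mem ιCfg ιLoc
    (withQQP τ L (fun m' => if m' ≤ i.k then cubeLamBP' L a M ρ i.k m' else fun _ => ∅) ops₀) hd2 hL1 hB₀ HA hM1 hMM₁ hMM₃
    (fun _ : Unit => i) (fun _ => by rw [hΩ]; exact margin2_cubeFam L a M (hL.trans hρL) i.k)
    (fun M' _ m' => (dictAt_withQQP_iff geo bg GA L mem ιCfg ιLoc τ _ ops₀ M' i m').2
      (hdict M' ⟨(i, a, M, ρ), hρL, hρM, hMbig, hLdM, hΩ, hΛs, hΛb⟩ m'))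
    (fun M' _ m' hM' => hP6 M' ⟨(i, a, M, ρ), hρL, hρM, hMbig, hLdM, hΩ, hΛs, hΛb⟩ m' hM')
    (fun M' _ m' hM' => hinv M' ⟨(i, a, M, ρ), hρL, hρM, hMbig, hLdM, hΩ, hΛs, hΛb⟩ m' hM')
    (fun M' _ m' hM' => (curvAt_withQQP_iff bg L mem ιCfg τ _ ops₀ c35 a₃ c69 M' i m').2
      (hcurv M' ⟨(i, a, M, ρ), hρL, hρM, hMbig, hLdM, hΩ, hΛs, hΛb⟩ m' hM'))
    (fun M' _ m' hM' => (landauAt_withQQP_iff bg L mem ιCfg τ _ ops₀ c35 a₃ M' i m').2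
      (hlan M' ⟨(i, a, M, ρ), hρL, hρM, hMbig, hLdM, hΩ, hΛs, hΛb⟩ m' hM'))
    (fun _ => fun m' => if m' ≤ i.k then cubeLamBP' L a M ρ i.k m' else fun _ => ∅)
    (fun M' _ m' => avgAtγ_withQQP τ L hd2 hL hCτ _ ops₀ M' i m' (levelSepPP_cubeLamBP'_trunc'_of_eq hL1 i a M hρL hΩ m'))
    (fun _ m' hm' => by
      intro j' hj' c hc
      have hc' : c ∈ cubeLamBP' L a M ρ i.k m' j' := by simpa only [if_pos hm'] using hc
      rw [hΩ]
      exact seesDom_cubeLamBP' hL1 a M hρL hm' j' hj' c hc')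
    hK₆ hc69 hq () m hm
  -- read the socket back at `cubeLamBP' … m = ΛbT m`
  exact sockB9P3D4β_of_level_eq L (by simp only [if_pos hm]) h

end Supply

/-! ## §2 The junction knit from Theorem 3.3 by name, edition γ, GENUINE AVERAGING LETTER, in the plug shape -/

section Knit

variable {I : Type} (geo : I → B9.Geometry) (bg : I → B9.Backgrounds) (GA : ∀ i, B9.KernelFamily (geo i) (bg i))
variable (L : ℕ) (mem : ℝ → ZdIdx d L → ℕ → I)
variable (ιCfg : ∀ (M : ℝ) (i : ZdIdx d L) (m : ℕ) (U₀ : Site d → Fin d → 𝔸ˣ), (∀ x κ, U₀ x κ ∈ unitaryUnits 𝔸) → (bg (mem M i m)).Cfg)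
variable (ιLoc : ∀ (M : ℝ) (i : ZdIdx d L) (m : ℕ), (Site d → Fin d → 𝔸) → (geo (mem M i m)).Loc)
variable (τ : 𝔸 →ₗ[ℂ] ℂ) (ops₀ : ℝ → ZdIdx d L → ℕ → OpsZd d 𝔸)

/-- ★★★ **PROPOSITION 6 ON THE CUBE MEMBERS FROM [4] THEOREM 3.3 BY NAME, EDITION γ, WITH THE GENUINE AVERAGING LETTER — D3γ's junction knit with the `havg` binder
DISCHARGED.**  `B9.Thm33Printed` + the member-local dictionary `DictAt` and letters `CurvAt`, `LandauAt` (at any `ops₀`), `Prop6At`, and `InvAt` at print's operator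
(3.26) WITH its averaging term `Q*aQ` (`withQQP τ L ΛbT ops₀`) on D3γ's datum-carrying cube sub-family give `∃ B₀ˢ ≥ 1, ∀ {B₀′ c_P} > 0, SockP5base@(B₀ˢ) →
SockP5@(B₀ˢ) → ∃ c₁ > 0, ∀ f, B8.Prop6Printed d L (5dL·B₀ˢ) c₁ (zdCub ∘ f)` — §1's socket family fed to D3γ's binder-agnostic consumer
`prop6Printed_zdCub_of_sockD4γFamily₃` at the synthetic cube member of each datum.  Same plug shape as `prop6Printed_zdCub_of_thm33γ₃` (this seat's K0 door
`prop6MemberB8At_of_prop6PrintedFamily` ∕ D2γ consume it verbatim); the averaging binder is no longer a hypothesis.  A6 line in the module docstring.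
[cite: Balaban1985RegularSpaces, Prop. 6 p.99, Prop. 3 p.87, Thm 4 p.88, Prop. 5 (1.107)–(1.108) p.94, (1.56)–(1.62) pp.86–87, (1.31) p.82, p.77; Balaban1985BackgroundPropagators, Thm 3.3 p.399, (3.16) p.393, (3.26)–(3.27) p.395; Balaban1984PropagatorsII, (2.3) p.224] -/
theorem prop6Printed_zdCub_of_thm33γ₄ (hd2 : 2 ≤ d) (hL : 2 ≤ L)
    {Cτ : ℝ} (hCτ : ∀ x y : 𝔸, |(τ (star x * y)).re| ≤ Cτ * ‖x‖ * ‖y‖)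
    {c35 c₆ K₆ M₃ a₃ c69 : ℝ} {Gp : ∀ i, B9.KernelFamily (geo i) (bg i)} (h33 : B9.Thm33Printed c35 geo bg Gp GA)
    (hdict : ∀ (M : ℝ) (j : {q : ZdIdx d L × (Site d × ℕ × ℕ) // L ≤ q.2.2.2 ∧ q.2.2.2 ≤ q.2.2.1 ∧ 11 * d < q.2.2.1 ∧ L ≤ d * q.2.2.1 ∧
          q.1.Ω = cubeFam false L q.2.1 q.2.2.1 q.2.2.2 q.1.k ∧ q.1.Λs = cubeLamS L q.2.1 q.2.2.1 q.2.2.2 q.1.k ∧ q.1.Λb = cubeLamB L q.2.1 q.2.2.1 q.2.2.2 q.1.k}) (m : ℕ),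
      DictAt geo bg GA L mem ιCfg ιLoc ops₀ M j.1.1 m)
    (hP6 : ∀ (M : ℝ) (j : {q : ZdIdx d L × (Site d × ℕ × ℕ) // L ≤ q.2.2.2 ∧ q.2.2.2 ≤ q.2.2.1 ∧ 11 * d < q.2.2.1 ∧ L ≤ d * q.2.2.1 ∧
          q.1.Ω = cubeFam false L q.2.1 q.2.2.1 q.2.2.2 q.1.k ∧ q.1.Λs = cubeLamS L q.2.1 q.2.2.1 q.2.2.2 q.1.k ∧ q.1.Λb = cubeLamB L q.2.1 q.2.2.1 q.2.2.2 q.1.k}) (m : ℕ),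
      M₃ ≤ M → Prop6At bg L mem ιCfg c35 c₆ K₆ M j.1.1 m)
    (hinv : ∀ (M : ℝ) (j : {q : ZdIdx d L × (Site d × ℕ × ℕ) // L ≤ q.2.2.2 ∧ q.2.2.2 ≤ q.2.2.1 ∧ 11 * d < q.2.2.1 ∧ L ≤ d * q.2.2.1 ∧
          q.1.Ω = cubeFam false L q.2.1 q.2.2.1 q.2.2.2 q.1.k ∧ q.1.Λs = cubeLamS L q.2.1 q.2.2.1 q.2.2.2 q.1.k ∧ q.1.Λb = cubeLamB L q.2.1 q.2.2.1 q.2.2.2 q.1.k}) (m : ℕ),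
      M₃ ≤ M → InvAt bg L mem ιCfg
        (withQQP τ L (fun m' => if m' ≤ j.1.1.k then cubeLamBP' L j.1.2.1 j.1.2.2.1 j.1.2.2.2 j.1.1.k m' else fun _ => ∅) ops₀) c35 a₃ M j.1.1 m)
    (hcurv : ∀ (M : ℝ) (j : {q : ZdIdx d L × (Site d × ℕ × ℕ) // L ≤ q.2.2.2 ∧ q.2.2.2 ≤ q.2.2.1 ∧ 11 * d < q.2.2.1 ∧ L ≤ d * q.2.2.1 ∧
          q.1.Ω = cubeFam false L q.2.1 q.2.2.1 q.2.2.2 q.1.k ∧ q.1.Λs = cubeLamS L q.2.1 q.2.2.1 q.2.2.2 q.1.k ∧ q.1.Λb = cubeLamB L q.2.1 q.2.2.1 q.2.2.2 q.1.k}) (m : ℕ),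
      M₃ ≤ M → CurvAt bg L mem ιCfg ops₀ c35 a₃ c69 M j.1.1 m)
    (hlan : ∀ (M : ℝ) (j : {q : ZdIdx d L × (Site d × ℕ × ℕ) // L ≤ q.2.2.2 ∧ q.2.2.2 ≤ q.2.2.1 ∧ 11 * d < q.2.2.1 ∧ L ≤ d * q.2.2.1 ∧
          q.1.Ω = cubeFam false L q.2.1 q.2.2.1 q.2.2.2 q.1.k ∧ q.1.Λs = cubeLamS L q.2.1 q.2.2.1 q.2.2.2 q.1.k ∧ q.1.Λb = cubeLamB L q.2.1 q.2.2.1 q.2.2.2 q.1.k}) (m : ℕ),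
      M₃ ≤ M → LandauAt bg L mem ιCfg ops₀ c35 a₃ M j.1.1 m)
    (hc₆ : 0 < c₆) (hK₆ : 0 < K₆) (ha₃ : 0 < a₃) (hc69 : 0 ≤ c69) :
    ∃ B₀S : ℝ, 1 ≤ B₀S ∧ ∀ {B₀' cP : ℝ}, 0 < B₀' → 0 < cP →
      (∀ (η : ℝ), 0 < η → ∀ (k : ℕ), 1 ≤ k → ∀ (a : Site d) (M ρ : ℕ), L ≤ ρ → ρ ≤ M → 11 * d < M → L ≤ d * M →
        SockP5base (𝔸 := 𝔸) L B₀S B₀' cP η k (cubeFam false L a M ρ k) (cubeLamS L a M ρ k)) →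
      (∀ (η : ℝ), 0 < η → ∀ (k : ℕ), 1 ≤ k → ∀ (a : Site d) (M ρ : ℕ), L ≤ ρ → ρ ≤ M → 11 * d < M → L ≤ d * M →
        SockP5 (𝔸 := 𝔸) L B₀S B₀' cP η k (cubeFam false L a M ρ k) (cubeLamS L a M ρ k)) →
      ∃ c₁ : ℝ, 0 < c₁ ∧ ∀ {ι' : Type} (f : ι' → ZdIdx d L),
        B8.Prop6Printed d (L : ℝ) (5 * (d : ℝ) * L * B₀S) c₁ (fun j => zdCub 𝔸 L (f j)) := by
  have hL1 : 1 ≤ L := le_trans (by norm_num) hL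
  -- §1: the explicit socket family over the split class at every member of `J′`, genuine averaging letter
  obtain ⟨B₀, cP9, hB₀, hcP9, hall⟩ := sockD4γ_cubeMember_of_thm33_genuineAvg geo bg GA L mem ιCfg ιLoc τ ops₀ hd2 hL hCτ h33 hdict hP6 hinv hcurv
    hlan hc₆ hK₆ ha₃ hc69
  have hBbd : 0 ≤ (20 * (d : ℝ) + 2) * max 1 (2 * B₀ * max 1 (qQ d L Cτ (betaTau τ) 1)) := by positivity
  refine ⟨max (max 1 (max 1 (2 * B₀ * max 1 (qQ d L Cτ (betaTau τ) 1))))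
      (4 * ((20 * (d : ℝ) + 2) * max 1 (2 * B₀ * max 1 (qQ d L Cτ (betaTau τ) 1))) / ((d : ℝ) * L - 1)),
    (le_max_left _ _).trans (le_max_left _ _), fun hB₀' hcP SP5base SP5 => ?_⟩
  -- D3γ's binder-agnostic consumer, fed at the synthetic cube member of each datum
  refine prop6Printed_zdCub_of_sockD4γFamily₃ (𝔸 := 𝔸) hd2 hL hBbd hcP9 hB₀' hcP (fun η hη k hk a M ρ hρL hρM hM hLdM m hm => ?_) SP5base SP5
  exact hall ⟨(⟨η, hη, k, hk, cubeFam false L a M ρ k, hΩ_cubeFam hL1 a M hρL k, cubeLamS L a M ρ k, cubeLamB L a M ρ k, hbox_cubeLamB L a M ρ k,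
      hclass_cubeLamB L a M ρ k, htower_cubeLam hL1 a M ρ k, hpart_cubeLam hL1 a M ρ k⟩, (a, M, ρ)), hρL, hρM, hM, hLdM, rfl, rfl, rfl⟩ m hm

#print axioms sockD4γ_cubeMember_of_thm33_genuineAvg
#print axioms prop6Printed_zdCub_of_thm33γ₄

end Knit

end Literature.MathematicalPhysics.QuantumFieldTheory.Balaban1983to89.B8Prop6CubeMemberOfThm33GammaAvg

end
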